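import Summits.CriticalPhenomena.SAWScalingLimit.Theorems.SAWCompassLatticeSurfaceUniversalityGlueV7
import Summits.CriticalPhenomena.SAWScalingLimit.Theses.SAWConfRestriction

/-!
# Orientation helper of the line `registered` (skeleton v7) for the crux `SurfaceUniversality`
# (stmt-CriticalPhenomena-6964): the line's `ℤ²`-side leaf against endpoint robustness (stmt-0776)

Route `SAWCompassLattice` (sub-problem `SAWScalingLimit`), `--supports stmt-CriticalPhenomena-6964`.
The line proves the crux from `SAWParafermion.EventualTight` (stmt-CriticalPhenomena-1881), its private
research leaf `LipSiteFaceApproxIndependence` (`…SurfaceUniversalityTightDefs.lean`) and a kernel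
statement. This file ORIENTS that leaf against the EXISTING item stmt-CriticalPhenomena-0776
`SAWConfRestriction.EndpointRobust` (two endpoint approximations of one Dobrushin domain give critical
`ℤ²` SAW laws merging on every bounded continuous test function of `CurveClass ℂ`):

* `lipEndpointRobust_of_lipSiteFaceApproxIndependence` — the `(false, false)` (site, site) instance of
  `LipSiteFaceApproxIndependence`, pushed through the landed site dictionary `stub_siteDictionary`
  (cost `≤ L·δ` on each side, eventually) and the landed admissibility `stub_siteApprox`, IS endpoint
  robustness of `SAW.law` on bounded LIPSCHITZ test functions;
* `endpointRobust_of_tight_of_lipSiteFaceApproxIndependence` —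
  `EventualTight → LipSiteFaceApproxIndependence → SAWConfRestriction.EndpointRobust`: the Lipschitz
  level is upgraded to `C_b` by the landed one-sided Prokhorov upgrade
  `tendsto_sub_of_isTightAlongMesh` (only the `(a, b)` side needs tightness);
* `lipPortEndpointRobust_of_lipSiteFaceApproxIndependence` — the `(true, true)` (face, face) instance:
  the plus law `plusLaw` between ports is endpoint robust on bounded Lipschitz test functions
  (admissibility and `plusLaw = plusPathLaw (probeSupport faceRule …)` eventually: `stub_faceSide`).

Planner consequence: given stmt-1881, stmt-0776 is NECESSARY for this line (its `ℤ²` leaf implies it).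
No new definition, no new hypothesis; `LipSiteFaceApproxIndependence` / `EventualTight` enter only as
explicit hypotheses.
-/

noncomputable section

namespace Summit.CriticalPhenomena.SAWScalingLimit.Theorems.SurfaceUniversality.EndpointRobustOfLine

open MeasureTheory Filter Topology Set
open scoped NNReal ENNReal BoundedContinuousFunction
open Literature.Probability.RandomPlanarGeometry
open Literature.Probability.RandomPlanarGeometry.SAW
open Literature.Probability.RandomPlanarGeometry.SAW.YangBaxter
open Literature.Probability.LatticeModels (Site meshDomain discreteDomainGraph discreteDomainGraph_adj_iff
  meshPoint)
open Summit.CriticalPhenomena.SAWScalingLimit.Theses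
open Summit.CriticalPhenomena.SAWScalingLimit.Theorems.SurfaceUniversality

/-! ### The site dictionary along the mesh filter -/

/-- **The site dictionary along `δ → 0⁺`**: under an endpoint approximation, the critical `ℤ²` SAW
law and the critical plus path law through the site support from the centres of the endpoints merge
on bounded Lipschitz test functions — eventually `‖·‖ ≤ L·δ` by `stub_siteDictionary`, since
eventually `a δ ∈ Ω_δ` (the two lattice endpoints are eventually distinct, their mesh points tending
to the distinct marked points, and joined, so `a δ` has an edge of `Ω_δ`; inlined as in the lead's
`…GlueV7.lean`). [folklore] -/
theorem er_tendsto_law_sub_sitePathLaw {D : DobrushinDomain} {a b : ℝ → Site 2}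
    (hab : SAW.IsEndpointApprox D a b) (f : BoundedContinuousFunction (CurveClass ℂ) ℝ) {L : ℝ≥0}
    (hf : LipschitzWith L f) :
    Tendsto (fun δ : ℝ => (∫ γ, f γ.curve ∂(SAW.law D.carrier δ (a δ) (b δ))) -
      ∫ x, f x ∂(plusPathLaw (probeSupport siteRule D.carrier δ) δ (siteCentre (a δ))
        (siteCentre (b δ)))) (𝓝[>] (0 : ℝ)) (𝓝 0) := by
  -- eventually `a δ ≠ b δ`
  have hne : ∀ᶠ δ in 𝓝[>] (0 : ℝ), a δ ≠ b δ := by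
    have hpt : D.pt 0 ≠ D.pt 1 := fun h => absurd (D.pt_injective h) (by decide)
    obtain ⟨U, V, hU, hV, h0, h1, hUV⟩ := t2_separation hpt
    filter_upwards [hab.tendsto_fst (hU.mem_nhds h0), hab.tendsto_snd (hV.mem_nhds h1)]
      with δ hδ0 hδ1 heq
    have h0' : meshPoint δ (a δ) ∈ U := hδ0
    have h1' : meshPoint δ (b δ) ∈ V := hδ1
    rw [heq] at h0'
    exact Set.disjoint_left.1 hUV h0' h1'
  -- eventually `a δ ∈ Ω_δ`
  have hmemD : ∀ᶠ δ in 𝓝[>] (0 : ℝ), a δ ∈ meshDomain D.carrier δ := by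
    filter_upwards [hab.reachable, hne] with δ hr hne'
    obtain ⟨p⟩ := hr
    have hlen : 0 < p.length :=
      Nat.pos_of_ne_zero fun h0 => hne' (SimpleGraph.Walk.eq_of_length_eq_zero h0)
    have hadj := p.adj_getVert_succ hlen
    rw [SimpleGraph.Walk.getVert_zero] at hadj
    exact (discreteDomainGraph_adj_iff.1 hadj).2.1
  have hdict : ∀ᶠ δ in 𝓝[>] (0 : ℝ), ‖(∫ γ, f γ.curve ∂(SAW.law D.carrier δ (a δ) (b δ))) -
      ∫ x, f x ∂(plusPathLaw (probeSupport siteRule D.carrier δ) δ (siteCentre (a δ))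
        (siteCentre (b δ)))‖ ≤ L * δ := by
    filter_upwards [hmemD, self_mem_nhdsWithin] with δ hmem hδ
    exact stub_siteDictionary D.carrier δ (a δ) (b δ) D.isBounded hδ hmem f L hf
  have hLδ : Tendsto (fun δ : ℝ => (L : ℝ) * δ) (𝓝[>] (0 : ℝ)) (𝓝 0) := by
    have h : Tendsto (fun δ : ℝ => (L : ℝ) * δ) (𝓝 (0 : ℝ)) (𝓝 ((L : ℝ) * 0)) :=
      tendsto_const_nhds.mul tendsto_id
    rw [mul_zero] at h
    exact tendsto_nhdsWithin_of_tendsto_nhds h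
  exact squeeze_zero_norm' hdict hLδ

/-! ### (1) Bounded-Lipschitz endpoint robustness of the `ℤ²` law -/

/-- **(1) `LipSiteFaceApproxIndependence` gives endpoint robustness of the critical `ℤ²` SAW law on
bounded Lipschitz test functions** (item stmt-CriticalPhenomena-0776 at Lipschitz level): the
`(false, false)` instance of the leaf on the centres of `(a, b)` and of `(a', b')` (both admissible for
the site rule, `stub_siteApprox`), and
`∫dP_{ab} − ∫dP_{a'b'} = (∫dP_{ab} − ∫dS_{ab}) + (∫dS_{ab} − ∫dS_{a'b'}) − (∫dP_{a'b'} − ∫dS_{a'b'})`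
with the two dictionary brackets `→ 0` (`er_tendsto_law_sub_sitePathLaw`). [folklore] -/
theorem lipEndpointRobust_of_lipSiteFaceApproxIndependence (hR : LipSiteFaceApproxIndependence) :
    ∀ (D : DobrushinDomain) (a b a' b' : ℝ → Site 2), SAW.IsEndpointApprox D a b →
      SAW.IsEndpointApprox D a' b' →
    ∀ (f : BoundedContinuousFunction (CurveClass ℂ) ℝ) (L : ℝ≥0), LipschitzWith L f →
      Tendsto (fun δ : ℝ => (∫ γ, f γ.curve ∂(SAW.law D.carrier δ (a δ) (b δ))) -
        ∫ γ, f γ.curve ∂(SAW.law D.carrier δ (a' δ) (b' δ))) (𝓝[>] (0 : ℝ)) (𝓝 0) := by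
  intro D a b a' b' hab hab' f L hf
  obtain ⟨hjS, huS, hvS⟩ := stub_siteApprox D a b hab
  obtain ⟨hjS', huS', hvS'⟩ := stub_siteApprox D a' b' hab'
  have hR' := hR D false false (fun δ => siteCentre (a δ)) (fun δ => siteCentre (b δ))
    (fun δ => siteCentre (a' δ)) (fun δ => siteCentre (b' δ)) hjS huS hvS hjS' huS' hvS' f L hf
  simp only [lineRule_false] at hR'
  have h1 := er_tendsto_law_sub_sitePathLaw hab f hf
  have h2 := er_tendsto_law_sub_sitePathLaw hab' f hf
  have h := (h1.add hR').sub h2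
  rw [add_zero, sub_zero] at h
  exact h.congr fun δ => by ring

/-! ### (2) Endpoint robustness BY NAME from tightness and the leaf -/

/-- **(2) `EventualTight → LipSiteFaceApproxIndependence → SAWConfRestriction.EndpointRobust`**
(stmt-1881 ∧ the line's `ℤ²` leaf `⇒` stmt-0776, BY NAME): the one-sided Prokhorov upgrade
`tendsto_sub_of_isTightAlongMesh` with the tight side `P δ := SAW.law Ω δ (a δ) (b δ)` observed through
`γ ↦ γ.curve` (a probability measure for small `δ`, `eventually_isProbabilityMeasure_law`; measurable on
the discrete walk space) and `ν δ :=` the push-forward of `SAW.law Ω δ (a' δ) (b' δ)` along `γ ↦ γ.curve`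
(a probability measure for small `δ`; NO tightness used on this side), the bounded-Lipschitz merging
being (1) moved along `integral_map`. [folklore] -/
theorem endpointRobust_of_tight_of_lipSiteFaceApproxIndependence (hT : SAWParafermion.EventualTight)
    (hR : LipSiteFaceApproxIndependence) : SAWConfRestriction.EndpointRobust := by
  intro D a b a' b' hab hab' f
  -- the `(a', b')` side as a family of laws on the curve space
  have hmap : ∀ (δ : ℝ) (g : CurveClass ℂ →ᵇ ℝ),
      ∫ x, g x ∂((SAW.law D.carrier δ (a' δ) (b' δ)).map (fun γ => γ.curve)) =
        ∫ γ, g γ.curve ∂(SAW.law D.carrier δ (a' δ) (b' δ)) :=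
    fun δ g => integral_map (SAW.DomainSAW.measurable_of_top _).aemeasurable
      g.continuous.aestronglyMeasurable
  have hν : ∀ᶠ δ in 𝓝[>] (0 : ℝ), IsProbabilityMeasure
      ((SAW.law D.carrier δ (a' δ) (b' δ)).map (fun γ => γ.curve)) := by
    filter_upwards
      [Summit.CriticalPhenomena.SAWScalingLimit.Theorems.SubseqIdentification.Negative.eventually_isProbabilityMeasure_law
        hab'] with δ hδ
    exact Measure.isProbabilityMeasure_map (SAW.DomainSAW.measurable_of_top _).aemeasurable
  have h := tendsto_sub_of_isTightAlongMesh
    (Summit.CriticalPhenomena.SAWScalingLimit.Theorems.SubseqIdentification.Negative.eventually_isProbabilityMeasure_law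
      hab)
    (Filter.Eventually.of_forall fun δ => SAW.aemeasurable_curve D.carrier δ (a δ) (b δ))
    (hT D a b hab) hν (fun g L hg => ?_) f
  · simpa only [hmap] using h
  · simpa only [hmap] using
      lipEndpointRobust_of_lipSiteFaceApproxIndependence hR D a b a' b' hab hab' g L hg

/-! ### (3) Bounded-Lipschitz endpoint robustness of the plus law between ports -/

/-- **(3) `LipSiteFaceApproxIndependence` gives endpoint robustness of the critical plus law between
ports on bounded Lipschitz test functions**: the `(true, true)` instance of the leaf on
`(inl ∘ a', inl ∘ b')` and `(inl ∘ a'', inl ∘ b'')` (both admissible for the face rule, and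
`plusLaw = plusPathLaw (probeSupport faceRule …) … (inl _) (inl _)` eventually: `stub_faceSide`).
[folklore] -/
theorem lipPortEndpointRobust_of_lipSiteFaceApproxIndependence (hR : LipSiteFaceApproxIndependence) :
    ∀ (D : DobrushinDomain) (a' b' a'' b'' : ℝ → MidEdge), IsYBEndpointApprox rightAngles D a' b' →
      IsYBEndpointApprox rightAngles D a'' b'' →
    ∀ (f : BoundedContinuousFunction (CurveClass ℂ) ℝ) (L : ℝ≥0), LipschitzWith L f →
      Tendsto (fun δ : ℝ => (∫ x, f x ∂(plusLaw D.carrier δ (a' δ) (b' δ))) -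
        ∫ x, f x ∂(plusLaw D.carrier δ (a'' δ) (b'' δ))) (𝓝[>] (0 : ℝ)) (𝓝 0) := by
  intro D a' b' a'' b'' hab' hab'' f L hf
  obtain ⟨hrestr', hjF', huF', hvF'⟩ := stub_faceSide D a' b' hab'
  obtain ⟨hrestr'', hjF'', huF'', hvF''⟩ := stub_faceSide D a'' b'' hab''
  have hR' := hR D true true (fun δ => Sum.inl (a' δ)) (fun δ => Sum.inl (b' δ))
    (fun δ => Sum.inl (a'' δ)) (fun δ => Sum.inl (b'' δ)) hjF' huF' hvF' hjF'' huF'' hvF'' f L hf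
  simp only [lineRule_true] at hR'
  refine hR'.congr' ?_
  filter_upwards [hrestr', hrestr''] with δ h' h''
  rw [h', h'']

end Summit.CriticalPhenomena.SAWScalingLimit.Theorems.SurfaceUniversality.EndpointRobustOfLine

end
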